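import Literature.Probability.FitznerVanDerHofstad2017.SrwIntegralLargeD
import HarnessLib

/-!
# Monotonicity in the dimension of the SRW inputs `I_{n,l}(0)` and `I_{n,l}(±e_μ)` for EVERY `l`
# (Fitzner–van der Hofstad 2021, §9, Def. 9.1 / Lemma 9.2 — the cases `x ∈ {0, ±e_μ}`, all `l`)

CITATION HEADER. Part of the certified REPRODUCTION of R. Fitzner, R. van der Hofstad,
*Generalized approach to the non-backtracking lace expansion*, PTRF **169** (2017) [NoBLE17] /
*Mean-field behavior for nearest-neighbor percolation in `d > 10`*, EJP **22** (2017) no. 43 [FvdH17]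
(the SRW inputs `I_{n,l}(x) = srwI d n l x`, [NoBLE17] (3.35)/(5.1)), and of the `d`-monotonicity
device of R. Fitzner, R. van der Hofstad, *NoBLE for lattice trees and lattice animals*, J. Stat. Phys.
**185** (2021) no. 13 [FvdH21], §9 (arXiv:1905.02785): Def. 9.1 "Let `g^{(d)} : ℤ^d → ℝ` be a family of
functions. Recall that we say that `g^{(d)}(x^{(d)})` is monotone in `d` when
`g^{(d+1)}((x^{(d)},0)) ≤ g^{(d)}(x^{(d)})`"; Lemma 9.2 (Monotonicity of SRW Green's function in `d`)
"for every `n ≥ 1` and `x^{(d)} ∈ ℤ^d` with `|x^{(d)}|_∞ ≤ 2`, `I^{(d)}_{n,0}(x^{(d)}) ≥ I^{(d+1)}_{n,0}(x^{(d+1)})`"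
(proved there via the Bessel representation of [HS92b]); and §9.1 p. 47 of the arXiv text: "As we
know that `I_{n,m}(x)` is monotone in `d` only for `m = 0` and appropriate values of `x`, it is a priori
not clear that these bounds are also monotone decreasing in `d`."

WHAT IS PROVED HERE (kernel, elementary — no Bessel functions): the tree's leave-one-out Jensen
argument of `SrwIntegralLargeD.lean` (tail analyst gen 4: `DimMono.integral_psi_succ_le` — `D̂_{d+1}(k)`
is the average of the `d+1` coordinate-deleted `D̂_d`'s, and the even part `ψ_{j,m}` of
`t ↦ t^m (1-t)^{-j}` is a non-negative combination of even powers, hence convex on `(-1,1)`) does NOT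
use the parity of `m`: its theorem `srwI_zero_dim_succ_le` carries a hypothesis `Even m` that its
proof never touches. Dropping it gives

* `srwI_zero_dim_succ_le_all` / `srwI_zero_dim_anti_all`: `I^{(d')}_{j,m}(0) ≤ I^{(d)}_{j,m}(0)` for
  ALL `m`, `2j+1 ≤ d ≤ d'` — i.e. [FvdH21] Lemma 9.2 at `x = 0` extended from `m = 0` to every `m`
  (sharper than the sentence of §9.1 quoted above, for `x = 0`);
* `srwI_single_dim_succ_le` / `srwI_single_dim_anti`: `I^{(d')}_{n,l}(e_{μ'}) ≤ I^{(d)}_{n,l}(e_μ)`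
  for all `l`, `2n+1 ≤ d ≤ d'` — Lemma 9.2 at the unit vectors (`|x|_∞ = 1`, one non-zero
  coordinate), every `l`, because `I_{n,l}(e_μ) = I_{n,l+1}(0)` (`srwI_single`, [NoBLE17] (3.34));
* `srwLaw_zero_dim_anti_all`: the `m`-step return probabilities `p^{(d)}_m(0)` are non-increasing in
  `d` for every `m` (odd `m`: both sides vanish).

NOT covered (and not claimed): `x` with two or more non-zero coordinates or with `|x_μ| = 2`
(the remaining cases of Lemma 9.2), and the integrals `K_{n,l}`, `T_{n,l}`, `U_n` for which [FvdH21]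
§9.1 itself proves no monotonicity ("we do not claim that all integrals, such as `U_n`, are monotone
decreasing in `d`, only that the bounds that we rely upon are").

## References
* [FvdH21] R. Fitzner, R. van der Hofstad, J. Stat. Phys. 185 (2021) no. 13, §9: Def. 9.1, Lemma 9.2,
  §9.1 (arXiv:1905.02785 pp. 46–47). [FitznerVanDerHofstad2021LTLA]
* [NoBLE17] R. Fitzner, R. van der Hofstad, PTRF 169 (2017) 1041–1119: (3.34)–(3.35) p. 1071, (5.1)
  p. 1090; §2.5 p. 1062 and §6 p. 1104 (monotonicity in `d`, asserted). [FitznerVanDerHofstad2016NoBLE]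
* [HS92b] T. Hara, G. Slade, Rev. Math. Phys. 4 (1992) 235–327, App. B (Bessel representation). [HaraSlade1992b]
-/

noncomputable section

open MeasureTheory Real Finset

namespace Literature.Probability.FitznerVanDerHofstad2017

open Literature.Barriers.CriticalPhenomena
open Literature.Barriers.CriticalPhenomena.Slade2006Prop53 (P μI)
open DimMono

variable {d : ℕ}

/-- **`d`-monotonicity of `I_{j,m}(0)` for EVERY `m`** (`d ≥ 2j+1`): `I^{(d+1)}_{j,m}(0) ≤ I^{(d)}_{j,m}(0)`.
The proof of `srwI_zero_dim_succ_le` verbatim, without its unused parity hypothesis.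
[cite: FitznerVanDerHofstad2021LTLA, §9 Def. 9.1 and Lemma 9.2 (x = 0; there m = 0 only)]
[cite: FitznerVanDerHofstad2016NoBLE, §2.5 p. 1062 and §6 p. 1104 (monotonicity in d, asserted)] -/
theorem srwI_zero_dim_succ_le_all {j : ℕ} (hd : 2 * j + 1 ≤ d) (m : ℕ) :
    srwI (d + 1) j m 0 ≤ srwI d j m 0 := by
  have hd1 : 2 * j + 1 ≤ d + 1 := by omega
  rw [srwI_zero_eq_integral_phi, srwI_zero_eq_integral_phi, ← integral_psi_Dhat hd1,
    ← integral_psi_Dhat hd, pow_succ]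
  calc (∫ k, psi j m (Dhat (d + 1) k) ∂P (d + 1)) / ((2 * π) ^ d * (2 * π))
      ≤ ((2 * π) * ∫ k, psi j m (Dhat d k) ∂P d) / ((2 * π) ^ d * (2 * π)) :=
        div_le_div_of_nonneg_right (integral_psi_succ_le hd m) (by positivity)
    _ = (∫ k, psi j m (Dhat d k) ∂P d) / (2 * π) ^ d := by
        rw [mul_comm (2 * π) (∫ k, psi j m (Dhat d k) ∂P d),
          mul_div_mul_right _ _ (by positivity : (2 : ℝ) * π ≠ 0)]

/-- `I^{(d')}_{j,m}(0) ≤ I^{(d)}_{j,m}(0)` for `2j+1 ≤ d ≤ d'` and every `m`.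
[cite: FitznerVanDerHofstad2021LTLA, §9 Def. 9.1 and Lemma 9.2 (x = 0)] -/
theorem srwI_zero_dim_anti_all {j m d d' : ℕ} (hd : 2 * j + 1 ≤ d) (hdd' : d ≤ d') :
    srwI d' j m 0 ≤ srwI d j m 0 := by
  induction d', hdd' using Nat.le_induction with
  | base => exact le_rfl
  | succ d' hle ih => exact (srwI_zero_dim_succ_le_all (by omega) m).trans ih

/-- The `m`-step return probabilities are non-increasing in `d` for every `m`:
`p^{(d')}_m(0) ≤ p^{(d)}_m(0)` (`1 ≤ d ≤ d'`). [cite: FitznerVanDerHofstad2021LTLA, §9 Def. 9.1] -/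
theorem srwLaw_zero_dim_anti_all {m d d' : ℕ} (hd : 1 ≤ d) (hdd' : d ≤ d') :
    LongRangePhi4.srwLaw d' m 0 ≤ LongRangePhi4.srwLaw d m 0 := by
  have h := srwI_zero_dim_anti_all (j := 0) (m := m) (by omega) hdd'
  rwa [srwI_zero_eq_srwLaw, srwI_zero_eq_srwLaw] at h

/-- **[FvdH21] Lemma 9.2 at the unit vectors, every `l`**: `I^{(d+1)}_{n,l}(e_{μ'}) ≤ I^{(d)}_{n,l}(e_μ)`
(`d ≥ 2n+1`; any coordinates `μ ≤ d`, `μ' ≤ d+1`), since `I_{n,l}(e_μ) = I_{n,l+1}(0)` (`srwI_single`).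
[cite: FitznerVanDerHofstad2021LTLA, §9.1 Lemma 9.2 (|x|_∞ ≤ 2; here x = e_μ)]
[cite: FitznerVanDerHofstad2016NoBLE, (3.34)–(3.35) p. 1071] -/
theorem srwI_single_dim_succ_le {n : ℕ} (hd : 2 * n + 1 ≤ d) (l : ℕ) (μ : Fin d) (μ' : Fin (d + 1)) :
    srwI (d + 1) n l (Pi.single μ' 1) ≤ srwI d n l (Pi.single μ 1) := by
  rw [srwI_single, srwI_single]
  exact srwI_zero_dim_succ_le_all hd (l + 1)

/-- `I^{(d')}_{n,l}(e_{μ'}) ≤ I^{(d)}_{n,l}(e_μ)` for `2n+1 ≤ d ≤ d'`, every `l`.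
[cite: FitznerVanDerHofstad2021LTLA, §9.1 Lemma 9.2 (x = e_μ)] -/
theorem srwI_single_dim_anti {n l d d' : ℕ} (hd : 2 * n + 1 ≤ d) (hdd' : d ≤ d')
    (μ : Fin d) (μ' : Fin d') : srwI d' n l (Pi.single μ' 1) ≤ srwI d n l (Pi.single μ 1) := by
  rw [srwI_single, srwI_single]
  exact srwI_zero_dim_anti_all hd hdd'

end Literature.Probability.FitznerVanDerHofstad2017

end
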